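import Summits.CriticalPhenomena.PercolationContinuityZ3.Theorems.SahiBoxTP2TiltHilbert
import Summits.CriticalPhenomena.PercolationContinuityZ3.Theorems.SahiBoxTP2WeakLimitsHilbert
import Summits.CriticalPhenomena.PercolationContinuityZ3.Theorems.SahiBoxTP2Transport

/-!
# Finite-volume Gibbs measures of ferromagnetic continuous-spin systems on `[0,1]^ℕ` and their limits are box-TP₂

Support file of the Sahi cell (`prim-sahi`, typer seat, generation 14; `--supports stmt-CriticalPhenomena-4575`).
Theorems only (no definitions, no named facts, no sorries).  The continuous-spin, model-independent analogue of
generation 13's Ising theorem (`SahiIsingBoxTP2.lean`: finite-volume Ising measures with any boundary condition and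
their limits are box-TP₂), obtained from this generation's tilt theorem (`SahiBoxTP2TiltHilbert.lean`) and weak
closure (`SahiBoxTP2WeakLimitsHilbert.lean`):

* `infinitePi_map_finRestrict_family`, `isBoxTP2_infinitePi` — every product probability measure `⊗_i μ_i` on
  `[0,1]^ℕ` (arbitrary one-dimensional laws, e.g. a priori single-spin measures inside a volume and Dirac masses at
  a boundary condition outside) is box-TP₂.
* `isBoxTP2_gibbs_hilbert` — the finite-volume Gibbs measure `e^{−H} · ⊗_i μ_i` with `H` continuous and submodular
  (`H (u ⊓ v) + H (u ⊔ v) ≤ H u + H v`: ferromagnetic / attractive pair or many-body interactions, arbitrary external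
  fields) is box-TP₂ — for EVERY choice of the one-dimensional laws, i.e. every boundary condition;
  `isBoxTP2_gibbs_hilbert_bc` spells out the boundary-condition form `μ_i = ν_i (i ∈ Λ)`, `= δ_{ω_i} (i ∉ Λ)`.
* `isBoxTP2_of_tendsto_gibbs_hilbert` — every weak limit (along any filter) of normalised such Gibbs measures, with
  volumes, boundary conditions, single-spin laws and interactions varying along the filter, is box-TP₂; hence
  (`integral_mul_integral_le_of_isBoxTP2_hilbert`, `msahiE_nonneg_of_isBoxTP2_hilbert_of_sahiConjecture`) FKG for all
  bounded measurable monotone functionals and, given `C_n`, Sahi positivity of every order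
  (`integral_mul_integral_le_of_tendsto_gibbs_hilbert`, `msahiE_nonneg_of_tendsto_gibbs_hilbert_of_sahiConjecture`).

No sorries, no new axioms.
-/

noncomputable section

namespace Summit.CriticalPhenomena.PercolationContinuityZ3.Theorems.SahiBoxTP2

open MeasureTheory Set Filter Topology Function Literature.Combinatorics.Sahi2008
open scoped ENNReal NNReal unitInterval

/-! ### Product measures on the Hilbert cube are box-TP₂ -/

section Product

variable {X : Type*} [MeasurableSpace X]

/-- **The initial-segment marginals of a product measure `⊗_i μ_i` on `ℕ → X` are the finite products
`⊗_{i<d} μ_i`.** [folklore] -/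
theorem infinitePi_map_finRestrict_family (μ : ℕ → Measure X) [∀ i, IsProbabilityMeasure (μ i)] (d : ℕ) :
    (Measure.infinitePi μ).map (finRestrict d) = Measure.pi (fun i : Fin d => μ i) := by
  refine (Measure.pi_eq fun t ht => ?_).symm
  rw [Measure.map_apply (measurable_finRestrict d) (MeasurableSet.univ_pi ht)]
  have hset : finRestrict d ⁻¹' Set.pi univ t =
      Set.pi (Finset.range d : Set ℕ) (fun i => if h : i < d then t ⟨i, h⟩ else univ) := by
    ext u
    simp only [mem_preimage, Set.mem_pi, mem_univ, true_implies, Finset.coe_range, mem_Iio]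
    constructor
    · intro hu i hi
      simp only [dif_pos hi]; exact hu ⟨i, hi⟩
    · intro hu i
      have := hu i i.2
      simp only [dif_pos i.2] at this
      exact this
  rw [hset, Measure.infinitePi_pi]
  · rw [← Fin.prod_univ_eq_prod_range (fun i => μ i (if h : i < d then t ⟨i, h⟩ else univ)) d]
    exact Finset.prod_congr rfl fun i _ => by rw [dif_pos i.2]
  · intro i hi
    rw [Finset.mem_range] at hi
    rw [dif_pos hi]; exact ht _

end Product

section Hilbert

/-- **Every product probability measure on the Hilbert cube is box-TP₂** (arbitrary one-dimensional laws: a priori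
single-spin measures, Dirac masses at boundary spins, …). [this work] -/
theorem isBoxTP2_infinitePi (μ : ℕ → Measure I) [∀ i, IsProbabilityMeasure (μ i)] :
    IsBoxTP2 (Measure.infinitePi μ) := by
  refine isBoxTP2_iff_forall_map_finRestrict_unitInterval.2 fun d => ?_
  rw [infinitePi_map_finRestrict_family μ d]
  exact IsBoxTP2.pi fun i : Fin d => μ i

/-- **Finite-volume Gibbs measures of ferromagnetic continuous-spin systems are box-TP₂, for every boundary
condition**: for any one-dimensional laws `μ_i` on `[0,1]` and any continuous submodular `H : [0,1]^ℕ → ℝ`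
(`H (u ⊓ v) + H (u ⊔ v) ≤ H u + H v`), the measure `e^{−H} · ⊗_i μ_i` is box-TP₂. [this work] -/
theorem isBoxTP2_gibbs_hilbert (μ : ℕ → Measure I) [∀ i, IsProbabilityMeasure (μ i)] {H : (ℕ → I) → ℝ}
    (hHc : Continuous H) (hH : ∀ u v, H (u ⊓ v) + H (u ⊔ v) ≤ H u + H v) :
    IsBoxTP2 ((Measure.infinitePi μ).withDensity fun u => ENNReal.ofReal (Real.exp (-H u))) :=
  (isBoxTP2_infinitePi μ).withDensity_exp_of_submodular_hilbert hHc hH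

/-- The boundary-condition form: single-spin laws `ν_i` inside the volume `Λ`, the configuration frozen at `ω`
outside. [this work] -/
theorem isBoxTP2_gibbs_hilbert_bc (Λ : Finset ℕ) (ν : ℕ → Measure I) [∀ i, IsProbabilityMeasure (ν i)] (ω : ℕ → I)
    {H : (ℕ → I) → ℝ} (hHc : Continuous H) (hH : ∀ u v, H (u ⊓ v) + H (u ⊔ v) ≤ H u + H v) :
    IsBoxTP2 ((Measure.infinitePi fun i => if i ∈ Λ then ν i else Measure.dirac (ω i)).withDensity
      fun u => ENNReal.ofReal (Real.exp (-H u))) := by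
  haveI : ∀ i, IsProbabilityMeasure (if i ∈ Λ then ν i else Measure.dirac (ω i)) := fun i => by
    split_ifs <;> infer_instance
  exact isBoxTP2_gibbs_hilbert _ hHc hH

variable {κ : Type*} {L : Filter κ} [NeBot L]

/-- **Every weak limit of finite-volume ferromagnetic Gibbs measures on `[0,1]^ℕ` is box-TP₂** — volumes, boundary
conditions / single-spin laws `μ^k_i` and continuous submodular interactions `H_k` may vary arbitrarily along the
filter; `μs k` is the normalised Gibbs measure `Z_k⁻¹ e^{−H_k} ⊗_i μ^k_i`. [this work] -/
theorem isBoxTP2_of_tendsto_gibbs_hilbert {μs : κ → ProbabilityMeasure (ℕ → I)} {μ : ProbabilityMeasure (ℕ → I)}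
    (hconv : Tendsto μs L (𝓝 μ))
    (hμs : ∀ k, ∃ (c : ℝ≥0∞) (P : ℕ → Measure I) (_ : ∀ i, IsProbabilityMeasure (P i)) (H : (ℕ → I) → ℝ),
      Continuous H ∧ (∀ u v, H (u ⊓ v) + H (u ⊔ v) ≤ H u + H v) ∧
        (μs k : Measure (ℕ → I)) = c • (Measure.infinitePi P).withDensity fun u => ENNReal.ofReal (Real.exp (-H u))) :
    IsBoxTP2 (μ : Measure (ℕ → I)) := by
  refine isBoxTP2_of_tendsto_probabilityMeasure_hilbert hconv (Eventually.of_forall fun k => ?_)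
  obtain ⟨c, P, hP, H, hHc, hH, hk⟩ := hμs k
  rw [hk]
  exact (isBoxTP2_gibbs_hilbert P hHc hH).smul c

/-- **FKG for weak limits of ferromagnetic continuous-spin Gibbs measures**, all nonnegative measurable monotone
functionals of the whole configuration. [this work] -/
theorem integral_mul_integral_le_of_tendsto_gibbs_hilbert {μs : κ → ProbabilityMeasure (ℕ → I)}
    {μ : ProbabilityMeasure (ℕ → I)} (hconv : Tendsto μs L (𝓝 μ))
    (hμs : ∀ k, ∃ (c : ℝ≥0∞) (P : ℕ → Measure I) (_ : ∀ i, IsProbabilityMeasure (P i)) (H : (ℕ → I) → ℝ),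
      Continuous H ∧ (∀ u v, H (u ⊓ v) + H (u ⊔ v) ≤ H u + H v) ∧
        (μs k : Measure (ℕ → I)) = c • (Measure.infinitePi P).withDensity fun u => ENNReal.ofReal (Real.exp (-H u)))
    {f g : (ℕ → I) → ℝ} (hfm : Measurable f) (hgm : Measurable g) (hf0 : ∀ u, 0 ≤ f u) (hg0 : ∀ u, 0 ≤ g u)
    (hf : Monotone f) (hg : Monotone g) :
    (∫ u, f u ∂(μ : Measure (ℕ → I))) * (∫ u, g u ∂(μ : Measure (ℕ → I))) ≤
      ∫ u, f u * g u ∂(μ : Measure (ℕ → I)) :=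
  integral_mul_integral_le_of_isBoxTP2_hilbert (μ : Measure (ℕ → I)) (isBoxTP2_of_tendsto_gibbs_hilbert hconv hμs)
    hfm hgm hf0 hg0 hf hg

/-- **Sahi positivity of every order for weak limits of ferromagnetic continuous-spin Gibbs measures, given `C_n`.**
[this work; conditional on Sahi's conjecture `C_n`] -/
theorem msahiE_nonneg_of_tendsto_gibbs_hilbert_of_sahiConjecture {n : ℕ} (hC : SahiConjecture n)
    {μs : κ → ProbabilityMeasure (ℕ → I)} {μ : ProbabilityMeasure (ℕ → I)} (hconv : Tendsto μs L (𝓝 μ))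
    (hμs : ∀ k, ∃ (c : ℝ≥0∞) (P : ℕ → Measure I) (_ : ∀ i, IsProbabilityMeasure (P i)) (H : (ℕ → I) → ℝ),
      Continuous H ∧ (∀ u v, H (u ⊓ v) + H (u ⊔ v) ≤ H u + H v) ∧
        (μs k : Measure (ℕ → I)) = c • (Measure.infinitePi P).withDensity fun u => ENNReal.ofReal (Real.exp (-H u)))
    (f : Fin n → (ℕ → I) → ℝ) (hfm : ∀ i, Measurable (f i)) (hf0 : ∀ i u, 0 ≤ f i u)
    (hmono : ∀ i, Monotone (f i)) : 0 ≤ msahiE (μ : Measure (ℕ → I)) n f :=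
  msahiE_nonneg_of_isBoxTP2_hilbert_of_sahiConjecture hC (μ : Measure (ℕ → I))
    (isBoxTP2_of_tendsto_gibbs_hilbert hconv hμs) f hfm hf0 hmono

end Hilbert

end Summit.CriticalPhenomena.PercolationContinuityZ3.Theorems.SahiBoxTP2
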